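import Summits.QuantumFields.BalabanUV.T4Continuum.Support.NE7CurvedRemainderCodifferential
import Summits.QuantumFields.BalabanUV.T4Continuum.Support.NE7CovariantInteriorGradient
import HarnessLib

/-!
# NE7GradientCurrencyCurved — THE GRADIENT CURRENCY FROM THE SUP CURRENCY AT A CURVED BACKGROUND (the curved twin of lineage #2's (157)
# `NE7GradientCurrency.norm_fdiff_le_of_plaqDiv_periodic`): for unitary `Per`-periodic `W` with plaquettes within `a`, a `Per`-periodic `Z` with `‖Z‖ ≤ ρ`,
# `J` a bound on the `W`-co-differential of the relative plaquette deviation `(W e^{Z})(∂p)·W(∂p)⁻¹ − 1`, `P` a bound on the covariant gradient of the covariant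
# divergence `covDiv W Z`, and a radius `R ≥ 1` with `32·d·R·(e^{4ρ} − 1) ≤ 1`: EVERY covariant forward difference of `Z` obeys
# `‖Ad_{W(y+e_κ,τ)}Z(y+e_τ,κ) − Z(y,κ)‖ ≤ 4·(dρ∕R + R·(J + P + (4d²R + 15d)·a·ρ)) + 2aρ`; file 52

Cell `pub-balaban`, rung (B)+1 sub-cell t4, lineage `b2b-balaban-t4-ne7-p1` (CRUX PROVER NE7 #1 = OWNER of row NE7), generation 79; memo
`t4/b2b-balaban-t4-ne7-p1-g79/GRADIENT-LETTER.md` §2.  File F121 (over F116 `NE7CovariantInteriorGradient.norm_cD_le_of_covLap`, F117 `NE7CovariantHodgeBond.norm_covLap_le_hodge`,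
F120 `NE7CurvedRemainderCodifferential.norm_codiff_siteCurl_le`, `NE3CovariantWeitzenbock` (`frame`, `cD_frame`, `cdiv_frame`, `covDiv`, `frame_periodic`),
`NE3CovariantCalculus.cD_periodic`, `AveragingDeficitCovGrad` (`covFd`, `units_id₁`, `norm_Ad_inv_sub_le`)).
WHY.  This is the letter `α₁^Z` of road (B) (F115 `hGradZ`: the gradient member of E′'s Landau representative `Z` at the CURVED tangent-critical background `W`) made a
consequence of three currencies the assembler already carries or the class data supply: the SUP `ρ = α_E` of `Z` (E′), the covariant DIVERGENCE of `Z` (E′ exports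
`‖covDiv W Z‖ ≤ b₀ + 3c_RE b₀`, so `P ≤ 2(b₀ + 3c_RE b₀)` trivially), and the flux-divergence datum `J` of the pair (`W e^{Z} = U^{u}`, `W`) — docked to
[Balaban1985RegularSpaces] (1.2) `B8Ineq132.covDiv` of `U` and of `W` in F122.  Mechanism: F116 (R37 in the axial gauge) bounds each covariant difference by
`2(dρ∕R + R·B′)` with `B′` the rough covariant Laplacian plus the curvature defect `4d(dR+1)aρ`; F117 (covariant Hodge) bounds the rough Laplacian by the curl
co-differential + the divergence gradient + `2daρ`; F120 bounds the curl co-differential by `J + 8d(e^{4ρ}−1)(G + aρ) + 8daρ` with `G` the maximal covariant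
difference; on the torus the maximum exists and the `G`-term is absorbed once `32dR(e^{4ρ} − 1) ≤ 1` (with `R = M`, `ρ = α_E ≤ 1∕64`: `256·d·M·α_E ≤ 1`).
WHAT ([folklore]; 0 def, 0 sorry).  §1 `norm_covLap_frame_le` (the rough covariant Laplacian of `A = frame W Z` from `J`, `P`, `G`), `norm_cD_frame_le_apriori` (F116 on top).
§2 **`norm_cD_frame_le_periodic`** (torus: the maximal covariant difference absorbed).  §3 the END-framed readings **`norm_covFd_le_periodic`** and
**`norm_gradMember_le_periodic`** (F115's `hGradZ` quantity: `+ 2aρ` for the plaquette between the two transports).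
HONEST FRAMING (page 1): elementary lattice analysis of OUR objects; `J` (flux divergences, (1.9) TYPE — class data ∕ R1+R2 material) and `P` (Landau reaction, E′) are
HYPOTHESES here; nothing of Bałaban's asserted; (APE) on curved data NOT proved unconditionally; NOT ONE-STEP, NOT NE7; spine 0∕9; finite T⁴ rung (B)+1 — NOT infinite volume,
NOT mass gap, NOT `BetaPertH`, NOT Clay.  Continuum YM on T⁴ ⇐ BetaPertH ∧ nine spine estimates (0/9 proved); BetaPertH ⇐ (D1) ∧ (D4) ∧ CAP+tail; G-an2-4 gates asym,
D1 and NE2/3/4.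
-/

set_option autoImplicit false

open scoped BigOperators Matrix Matrix.Norms.L2Operator
open NormedSpace Finset

namespace Summit.QuantumFields.BalabanUV.T4Continuum.NE7GradientCurrencyCurved

open Literature.MathematicalPhysics.QuantumFieldTheory.Balaban1983to89
open B7Prop1Explicit B7Prop2Explicit
open T4AveragingDeficitWall (Ad IsUnitaryCfg SmallField vary)
open T4AveragingDeficitWallBoundary (IsPeriodicCfg periodBox mem_periodBox)
open AveragingDeficitPeriodicCounting (IsPeriodicDir)
open AveragingDeficitTorusChart (periodic_smul_vec)
open SkeletonLattice (cmod smul_cdiv_add_cmod cmod_nonneg cmod_lt)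
open T4AveragingDeficitNonAbelian (Ad_mul Ad_sub)
open AveragingDeficitTransport (norm_Ad_of_unitary)
open AveragingDeficitCovGrad (covFd units_id₁ norm_Ad_inv_sub_le)
open NE3CovariantCalculus (cD cDstar cD_periodic)
open NE3CovariantWeitzenbock (frame cD_frame cdiv_frame covDiv norm_frame frame_periodic)
open NE7CovariantHodgeBond (norm_covLap_le_hodge norm_hol_plaqWord_sub_one_le)
open NE7CovariantInteriorGradient (norm_cD_le_of_covLap)
open NE7CurvedRemainderCodifferential (norm_codiff_siteCurl_le)

noncomputable section

variable {d : ℕ} {n : Type*} [Fintype n] [DecidableEq n]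

/-! ## §1 The rough covariant Laplacian of `A = frame W Z` from the data, and the a priori gradient bound -/

/-- **THE ROUGH COVARIANT LAPLACIAN OF `A = frame W Z`** from the relative-plaquette co-differential `J`, the divergence gradient `P`, the sup `ρ` and the a priori
covariant-gradient bound `G`: `‖Σ_μ (∇_μ + ∇_μ^†) A_ν (x)‖ ≤ J + 8d(e^{4ρ}−1)(G + aρ) + 8daρ + P + 2daρ`. [folklore] -/
theorem norm_covLap_frame_le [Nonempty n] {W : Site d → Fin d → (Matrix n n ℂ)ˣ} (hW : IsUnitaryCfg W) {a : ℝ} (ha : 0 ≤ a) (hWa : SmallField W a)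
    (Z : Site d → Fin d → Matrix n n ℂ) {ρ G J P : ℝ} (hZ : ∀ y κ, ‖Z y κ‖ ≤ ρ)
    (hG : ∀ (y : Site d) (τ κ : Fin d), ‖cD W τ (fun z => frame W Z z κ) y‖ ≤ G)
    (hJ : ∀ (x : Site d) (ν : Fin d), ‖∑ μ, cDstar W μ (fun y => ((hol (vary W Z 1) y (plaqWord μ ν) : (Matrix n n ℂ)ˣ) : Matrix n n ℂ)
        * (((hol W y (plaqWord μ ν))⁻¹ : (Matrix n n ℂ)ˣ) : Matrix n n ℂ) - 1) x‖ ≤ J)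
    (hP : ∀ (x : Site d) (ν : Fin d), ‖cD W ν (covDiv W Z) x‖ ≤ P) (x : Site d) (ν : Fin d) :
    ‖∑ μ, (cD W μ (fun y => frame W Z y ν) x + cDstar W μ (fun y => frame W Z y ν) x)‖
      ≤ (J + 8 * d * (Real.exp (4 * ρ) - 1) * (G + a * ρ) + 8 * d * (a * ρ)) + P + 2 * d * a * ρ := by
  have hdiv : NE3CovariantCalculus.cdiv W (frame W Z) = covDiv W Z := funext fun y => cdiv_frame W Z y
  have hP' : ‖cD W ν (NE3CovariantCalculus.cdiv W (frame W Z)) x‖ ≤ P := by rw [hdiv]; exact hP x ν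
  exact norm_covLap_le_hodge hW ha hWa (frame W Z) (fun y κ => by rw [norm_frame hW]; exact hZ y κ) x ν
    (norm_codiff_siteCurl_le hW ha hWa Z hZ hG x ν (hJ x ν)) hP'

/-- **THE A PRIORI FORM**: under the hypotheses of `norm_covLap_frame_le` and `R ≥ 1`, every covariant forward difference of `A = frame W Z` obeys
`‖∇_τ A_ν(x₀)‖ ≤ 2·(dρ∕R + R·(J + 8d(e^{4ρ}−1)(G + aρ) + 8daρ + P + 2daρ + 4d(dR+1)aρ))` (F116 on top of §1). [folklore] -/
theorem norm_cD_frame_le_apriori [Nonempty n] {W : Site d → Fin d → (Matrix n n ℂ)ˣ} (hW : IsUnitaryCfg W) {a : ℝ} (ha : 0 ≤ a) (hWa : SmallField W a)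
    (Z : Site d → Fin d → Matrix n n ℂ) {ρ G J P : ℝ} (hZ : ∀ y κ, ‖Z y κ‖ ≤ ρ)
    (hG : ∀ (y : Site d) (τ κ : Fin d), ‖cD W τ (fun z => frame W Z z κ) y‖ ≤ G)
    (hJ : ∀ (x : Site d) (ν : Fin d), ‖∑ μ, cDstar W μ (fun y => ((hol (vary W Z 1) y (plaqWord μ ν) : (Matrix n n ℂ)ˣ) : Matrix n n ℂ)
        * (((hol W y (plaqWord μ ν))⁻¹ : (Matrix n n ℂ)ˣ) : Matrix n n ℂ) - 1) x‖ ≤ J)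
    (hP : ∀ (x : Site d) (ν : Fin d), ‖cD W ν (covDiv W Z) x‖ ≤ P) {R : ℕ} (hR : 1 ≤ R) (x₀ : Site d) (τ ν : Fin d) :
    ‖cD W τ (fun y => frame W Z y ν) x₀‖
      ≤ 2 * ((d : ℝ) * ρ / R + R * (((J + 8 * d * (Real.exp (4 * ρ) - 1) * (G + a * ρ) + 8 * d * (a * ρ)) + P + 2 * d * a * ρ)
          + 4 * d * ((d : ℝ) * R + 1) * a * ρ)) :=
  norm_cD_le_of_covLap hW ha hWa (fun y => frame W Z y ν) (fun y => by rw [norm_frame hW]; exact hZ y ν)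
    (fun y => norm_covLap_frame_le hW ha hWa Z hZ hG hJ hP y ν) hR x₀ τ

/-! ## §2 On the torus: the maximal covariant difference is absorbed -/

/-- **THE GRADIENT CURRENCY FROM THE SUP CURRENCY AT A CURVED BACKGROUND, SITE-FRAMED FORM.**  For `d ≥ 1`, unitary `Per`-periodic `W` (`Per ≥ 1`) with
`SmallField W a`, `Per`-periodic `Z` with `‖Z‖ ≤ ρ`, the data `J` (relative-plaquette co-differential) and `P` (divergence gradient) as in §1, and `R ≥ 1` with
`32·d·R·(e^{4ρ} − 1) ≤ 1`: `‖∇_τ (frame W Z)_ν (x)‖ ≤ 4·(dρ∕R + R·(J + P + (4d²R + 15d)·a·ρ))` at every site and pair of directions. [folklore] -/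
theorem norm_cD_frame_le_periodic [Nonempty n] (hd : 1 ≤ d) {Per : ℕ} (hPer : 1 ≤ Per)
    {W : Site d → Fin d → (Matrix n n ℂ)ˣ} (hW : IsUnitaryCfg W) (hWP : IsPeriodicCfg W (Per : ℤ)) {a : ℝ} (ha : 0 ≤ a) (hWa : SmallField W a)
    (Z : Site d → Fin d → Matrix n n ℂ) (hZP : IsPeriodicDir Z (Per : ℤ)) {ρ J P : ℝ} (hZ : ∀ y κ, ‖Z y κ‖ ≤ ρ)
    (hJ : ∀ (x : Site d) (ν : Fin d), ‖∑ μ, cDstar W μ (fun y => ((hol (vary W Z 1) y (plaqWord μ ν) : (Matrix n n ℂ)ˣ) : Matrix n n ℂ)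
        * (((hol W y (plaqWord μ ν))⁻¹ : (Matrix n n ℂ)ˣ) : Matrix n n ℂ) - 1) x‖ ≤ J)
    (hP : ∀ (x : Site d) (ν : Fin d), ‖cD W ν (covDiv W Z) x‖ ≤ P)
    {R : ℕ} (hR : 1 ≤ R) (hsmall : 32 * (d : ℝ) * R * (Real.exp (4 * ρ) - 1) ≤ 1) (x : Site d) (τ ν : Fin d) :
    ‖cD W τ (fun y => frame W Z y ν) x‖ ≤ 4 * ((d : ℝ) * ρ / R + R * (J + P + (4 * (d : ℝ) ^ 2 * R + 15 * d) * a * ρ)) := by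
  classical
  -- the maximal covariant forward difference over one period
  set S : Finset (Site d × Fin d × Fin d) :=
    (periodBox (d := d) Per) ×ˢ ((Finset.univ : Finset (Fin d)) ×ˢ (Finset.univ : Finset (Fin d))) with hS_def
  have hmemS : ∀ (y : Site d) (i j : Fin d), (cmod Per y, i, j) ∈ S := fun y i j => by
    rw [hS_def, Finset.mem_product, Finset.mem_product]
    exact ⟨(mem_periodBox).2 fun k => ⟨cmod_nonneg hPer y k, cmod_lt hPer y k⟩, Finset.mem_univ _, Finset.mem_univ _⟩
  have hSne : S.Nonempty := ⟨_, hmemS 0 ⟨0, hd⟩ ⟨0, hd⟩⟩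
  obtain ⟨q₀, -, hq₀max⟩ := Finset.exists_max_image S (fun q => ‖cD W q.2.2 (fun z => frame W Z z q.2.1) q.1‖) hSne
  set G : ℝ := ‖cD W q₀.2.2 (fun z => frame W Z z q₀.2.1) q₀.1‖ with hG_def
  -- every covariant forward difference is bounded by `G` (periodicity)
  have hper : ∀ (i j : Fin d) (y : Site d) (k : Fin d), cD W j (fun z => frame W Z z i) (y + (Per : ℤ) • e k) = cD W j (fun z => frame W Z z i) y :=
    fun i j y k => cD_periodic hWP j (fun z k' => frame_periodic hWP hZP z k' i) y k
  have hGall : ∀ (y : Site d) (j i : Fin d), ‖cD W j (fun z => frame W Z z i) y‖ ≤ G := by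
    intro y j i
    have hy : y = cmod Per y + (Per : ℤ) • SkeletonLattice.cdiv Per y := by rw [add_comm, smul_cdiv_add_cmod]
    have h1 : cD W j (fun z => frame W Z z i) y = cD W j (fun z => frame W Z z i) (cmod Per y) := by
      have h := periodic_smul_vec (f := fun z => cD W j (fun z => frame W Z z i) z) (N := (Per : ℤ)) (hper i j) (cmod Per y) (SkeletonLattice.cdiv Per y)
      rwa [← hy] at h
    rw [h1]
    have hm := hq₀max (cmod Per y, i, j) (hmemS y i j)
    simpa only using hm
  -- §1 at the maximising bond, then absorb
  have hkey := norm_cD_frame_le_apriori hW ha hWa Z hZ (fun y τ' κ => hGall y τ' κ) hJ hP hR q₀.1 q₀.2.2 q₀.2.1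
  rw [← hG_def] at hkey
  have hR1 : (1 : ℝ) ≤ R := by exact_mod_cast hR
  have hd1 : (1 : ℝ) ≤ d := by exact_mod_cast hd
  have hρ0 : 0 ≤ ρ := (norm_nonneg _).trans (hZ 0 ⟨0, hd⟩)
  have hE : 0 ≤ Real.exp (4 * ρ) - 1 := by have := Real.one_le_exp (by positivity : 0 ≤ 4 * ρ); linarith
  have hG0 : 0 ≤ G := norm_nonneg _
  have hJ0 : 0 ≤ J := (norm_nonneg _).trans (hJ 0 ⟨0, hd⟩)
  have hP0 : 0 ≤ P := (norm_nonneg _).trans (hP 0 ⟨0, hd⟩)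
  have haρ : 0 ≤ a * ρ := mul_nonneg ha hρ0
  -- the `G`-term on the right is at most `G∕2`
  have habs : 2 * (R * (8 * d * (Real.exp (4 * ρ) - 1) * G)) ≤ G / 2 := by
    have h1 : (32 * (d : ℝ) * R * (Real.exp (4 * ρ) - 1)) * G ≤ 1 * G := mul_le_mul_of_nonneg_right hsmall hG0
    nlinarith
  -- the curvature constants: `8d(e^{4ρ}−1) ≤ d`
  have hEd : 8 * d * (Real.exp (4 * ρ) - 1) ≤ d := by
    have h1 : 8 * (d : ℝ) * (Real.exp (4 * ρ) - 1) ≤ 8 * d * R * (Real.exp (4 * ρ) - 1) := by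
      have : 8 * (d : ℝ) * (Real.exp (4 * ρ) - 1) * 1 ≤ 8 * d * (Real.exp (4 * ρ) - 1) * R :=
        mul_le_mul_of_nonneg_left hR1 (by positivity)
      linarith
    nlinarith
  have hGle : G ≤ 4 * ((d : ℝ) * ρ / R + R * (J + P + (4 * (d : ℝ) ^ 2 * R + 15 * d) * a * ρ)) := by
    have hsplit : 2 * ((d : ℝ) * ρ / R + R * (((J + 8 * d * (Real.exp (4 * ρ) - 1) * (G + a * ρ) + 8 * d * (a * ρ)) + P + 2 * d * a * ρ)
          + 4 * d * ((d : ℝ) * R + 1) * a * ρ))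
        = 2 * ((d : ℝ) * ρ / R + R * (J + P + (8 * d * (Real.exp (4 * ρ) - 1) + 10 * d + 4 * d * ((d : ℝ) * R + 1)) * (a * ρ)))
          + 2 * (R * (8 * d * (Real.exp (4 * ρ) - 1) * G)) := by ring
    rw [hsplit] at hkey
    have hc : (8 * d * (Real.exp (4 * ρ) - 1) + 10 * d + 4 * d * ((d : ℝ) * R + 1)) * (a * ρ) ≤ (4 * (d : ℝ) ^ 2 * R + 15 * d) * a * ρ := by
      have : (8 * d * (Real.exp (4 * ρ) - 1) + 10 * d + 4 * d * ((d : ℝ) * R + 1)) ≤ 4 * (d : ℝ) ^ 2 * R + 15 * d := by nlinarith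
      calc _ ≤ (4 * (d : ℝ) ^ 2 * R + 15 * d) * (a * ρ) := mul_le_mul_of_nonneg_right this haρ
        _ = _ := by ring
    have hR0 : (0 : ℝ) ≤ R := by positivity
    have h2 : 2 * ((d : ℝ) * ρ / R + R * (J + P + (8 * d * (Real.exp (4 * ρ) - 1) + 10 * d + 4 * d * ((d : ℝ) * R + 1)) * (a * ρ)))
        ≤ 2 * ((d : ℝ) * ρ / R + R * (J + P + (4 * (d : ℝ) ^ 2 * R + 15 * d) * a * ρ)) := by
      gcongr
    linarith
  exact (hGall x τ ν).trans hGle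

/-! ## §3 The END-framed readings -/

/-- **THE GRADIENT CURRENCY AT A CURVED BACKGROUND, ROW NE3-R2 FORM**: `‖covFd W Z x τ ν‖ ≤ 4·(dρ∕R + R·(J + P + (4d²R + 15d)·a·ρ))`. [folklore] -/
theorem norm_covFd_le_periodic [Nonempty n] (hd : 1 ≤ d) {Per : ℕ} (hPer : 1 ≤ Per)
    {W : Site d → Fin d → (Matrix n n ℂ)ˣ} (hW : IsUnitaryCfg W) (hWP : IsPeriodicCfg W (Per : ℤ)) {a : ℝ} (ha : 0 ≤ a) (hWa : SmallField W a)
    (Z : Site d → Fin d → Matrix n n ℂ) (hZP : IsPeriodicDir Z (Per : ℤ)) {ρ J P : ℝ} (hZ : ∀ y κ, ‖Z y κ‖ ≤ ρ)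
    (hJ : ∀ (x : Site d) (ν : Fin d), ‖∑ μ, cDstar W μ (fun y => ((hol (vary W Z 1) y (plaqWord μ ν) : (Matrix n n ℂ)ˣ) : Matrix n n ℂ)
        * (((hol W y (plaqWord μ ν))⁻¹ : (Matrix n n ℂ)ˣ) : Matrix n n ℂ) - 1) x‖ ≤ J)
    (hP : ∀ (x : Site d) (ν : Fin d), ‖cD W ν (covDiv W Z) x‖ ≤ P)
    {R : ℕ} (hR : 1 ≤ R) (hsmall : 32 * (d : ℝ) * R * (Real.exp (4 * ρ) - 1) ≤ 1) (x : Site d) (τ ν : Fin d) :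
    ‖covFd W Z x τ ν‖ ≤ 4 * ((d : ℝ) * ρ / R + R * (J + P + (4 * (d : ℝ) ^ 2 * R + 15 * d) * a * ρ)) := by
  rw [← cD_frame]
  exact norm_cD_frame_le_periodic hd hPer hW hWP ha hWa Z hZP hZ hJ hP hR hsmall x τ ν

/-- The END-framed gradient member of F115's `hGradZ` against the site-framed covariant difference: for unitary `W` with the plaquette at `(y; τ, κ)` within `a`,
`‖Ad_{W(y+e_κ,τ)}Z(y+e_τ,κ) − Z(y,κ)‖ ≤ ‖covFd W Z y τ κ‖ + 2a·‖Z(y+e_τ,κ)‖` (the two transports differ by the plaquette). [folklore] -/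
theorem norm_gradMember_le_covFd [Nonempty n] {W : Site d → Fin d → (Matrix n n ℂ)ˣ} (hW : IsUnitaryCfg W) (Z : Site d → Fin d → Matrix n n ℂ)
    (y : Site d) (τ κ : Fin d) {a : ℝ} (hp : ‖((hol W y (plaqWord τ κ) : (Matrix n n ℂ)ˣ) : Matrix n n ℂ) - 1‖ ≤ a) :
    ‖Ad (W (y + e κ) τ) (Z (y + e τ) κ) - Z y κ‖ ≤ ‖covFd W Z y τ κ‖ + 2 * a * ‖Z (y + e τ) κ‖ := by
  have hPu : hol W y (plaqWord τ κ) ∈ unitaryUnits (Matrix n n ℂ) := hol_mem_of hW _ _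
  have h12 : W y τ * W (y + e τ) κ ∈ unitaryUnits (Matrix n n ℂ) := (unitaryUnits _).mul_mem (hW _ _) (hW _ _)
  -- transport to the frame at `y` by `Ad_{W(y,κ)}`
  have hid : Ad (W y κ) (Ad (W (y + e κ) τ) (Z (y + e τ) κ) - Z y κ)
      = covFd W Z y τ κ + (Ad (hol W y (plaqWord τ κ))⁻¹ (Ad (W y τ * W (y + e τ) κ) (Z (y + e τ) κ)) - Ad (W y τ * W (y + e τ) κ) (Z (y + e τ) κ)) := by
    rw [Ad_sub, ← Ad_mul, units_id₁ W y τ κ, Ad_mul]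
    simp only [covFd]
    abel
  rw [← norm_Ad_of_unitary (hW y κ), hid]
  refine (norm_add_le _ _).trans (add_le_add le_rfl ?_)
  refine (norm_Ad_inv_sub_le hPu _).trans ?_
  rw [norm_Ad_of_unitary h12]
  gcongr

/-- **THE GRADIENT CURRENCY AT A CURVED BACKGROUND, F115's `hGradZ` FORM**: under the hypotheses of `norm_cD_frame_le_periodic`,
`‖Ad_{W(y+e_κ,τ)}Z(y+e_τ,κ) − Z(y,κ)‖ ≤ 4·(dρ∕R + R·(J + P + (4d²R + 15d)·a·ρ)) + 2aρ` everywhere. [folklore] -/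
theorem norm_gradMember_le_periodic [Nonempty n] (hd : 1 ≤ d) {Per : ℕ} (hPer : 1 ≤ Per)
    {W : Site d → Fin d → (Matrix n n ℂ)ˣ} (hW : IsUnitaryCfg W) (hWP : IsPeriodicCfg W (Per : ℤ)) {a : ℝ} (ha : 0 ≤ a) (hWa : SmallField W a)
    (Z : Site d → Fin d → Matrix n n ℂ) (hZP : IsPeriodicDir Z (Per : ℤ)) {ρ J P : ℝ} (hZ : ∀ y κ, ‖Z y κ‖ ≤ ρ)
    (hJ : ∀ (x : Site d) (ν : Fin d), ‖∑ μ, cDstar W μ (fun y => ((hol (vary W Z 1) y (plaqWord μ ν) : (Matrix n n ℂ)ˣ) : Matrix n n ℂ)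
        * (((hol W y (plaqWord μ ν))⁻¹ : (Matrix n n ℂ)ˣ) : Matrix n n ℂ) - 1) x‖ ≤ J)
    (hP : ∀ (x : Site d) (ν : Fin d), ‖cD W ν (covDiv W Z) x‖ ≤ P)
    {R : ℕ} (hR : 1 ≤ R) (hsmall : 32 * (d : ℝ) * R * (Real.exp (4 * ρ) - 1) ≤ 1) (y : Site d) (κ τ : Fin d) :
    ‖Ad (W (y + e κ) τ) (Z (y + e τ) κ) - Z y κ‖ ≤ 4 * ((d : ℝ) * ρ / R + R * (J + P + (4 * (d : ℝ) ^ 2 * R + 15 * d) * a * ρ)) + 2 * a * ρ := by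
  refine (norm_gradMember_le_covFd hW Z y τ κ (norm_hol_plaqWord_sub_one_le ha hWa y τ κ)).trans ?_
  exact add_le_add (norm_covFd_le_periodic hd hPer hW hWP ha hWa Z hZP hZ hJ hP hR hsmall y τ κ)
    (mul_le_mul_of_nonneg_left (hZ _ _) (by positivity))

end

end Summit.QuantumFields.BalabanUV.T4Continuum.NE7GradientCurrencyCurved
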